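import Mathlib
import Literature.Computability.AlgebraicComplexity.NewtonPolygonKPTTProp1
import HarnessLib

/-!
# KPTT 2015, Proposition 1 — proof (`KPTT.kptt_proposition1_holds`)

Proof of `KPTT.proposition1` (`NewtonPolygonKPTTProp1`): Example 3 of KPTT (`P_k = {(b^{2k} i, b^k j) : i < b², j < b}`,
whose Minkowski sum contains the grid `[0, b^{2m}) × [0, b^m)`, by base-`b²` / base-`b` digit expansion) and a convex chain in
that grid.  For the chain we use the parabola points `(j², j)`, `j < b^m - 1` (KPTT's Lemma 2 uses the triangular numbers
`(j(j-1)/2, j)`; either chain fits, since `(b^m - 2)² < b^{2m}`): the linear functional `(x, y) ↦ x - 2k·y` is minimised on the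
chain exactly at `j = k` (`(j-k)² > 0`), so no chain point lies in the convex hull of the others.  Elementary; no named facts.
[cite: KoiranPortierTavenasThomasse2015, Proposition 1, Example 3, Lemma 2]
-/

noncomputable section

namespace Literature.Computability.AlgebraicComplexity.KPTT

open scoped Pointwise

/-- Example 3 of KPTT: `P_k = {(b^{2k} i, b^k j) : 0 ≤ i < b², 0 ≤ j < b} ⊂ ℝ²`. [cite: KoiranPortierTavenasThomasse2015, Example 3] -/
def example3Set (b k : ℕ) : Finset (Fin 2 → ℝ) :=
  ((Finset.range (b ^ 2)) ×ˢ (Finset.range b)).image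
    fun ij => ![(b : ℝ) ^ (2 * k) * (ij.1 : ℝ), (b : ℝ) ^ k * (ij.2 : ℝ)]

/-- `#P_k = b³` for `b ≥ 1` (KPTT Example 3: "sets of `t = b³` points"). [cite: KoiranPortierTavenasThomasse2015, Example 3] -/
theorem card_example3Set (b k : ℕ) (hb : 1 ≤ b) : (example3Set b k).card = b ^ 3 := by
  unfold example3Set
  rw [Finset.card_image_of_injective, Finset.card_product, Finset.card_range, Finset.card_range]
  · ring
  · rintro ⟨i, j⟩ ⟨i', j'⟩ h
    have h0 := congrFun h 0
    have h1 := congrFun h 1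
    simp only [Matrix.cons_val_zero, Matrix.cons_val_one] at h0 h1
    have hbpos : (0 : ℝ) < b := by exact_mod_cast hb
    have hi : (i : ℝ) = i' := (mul_right_inj' (pow_ne_zero _ hbpos.ne')).1 h0
    have hj : (j : ℝ) = j' := (mul_right_inj' (pow_ne_zero _ hbpos.ne')).1 h1
    exact Prod.ext (by exact_mod_cast hi) (by exact_mod_cast hj)

/-- **The Minkowski sum `Σ_{k<m} P_k` contains the grid `[0, b^{2m}) × [0, b^m)`** (digit expansion in bases `b²` and `b`).
[cite: KoiranPortierTavenasThomasse2015, Example 3] -/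
theorem grid_mem_sum_example3Set (b : ℕ) (hb : 1 ≤ b) :
    ∀ (m x y : ℕ), x < (b ^ 2) ^ m → y < b ^ m →
      (![(x : ℝ), (y : ℝ)] : Fin 2 → ℝ) ∈ ∑ k : Fin m, example3Set b k := by
  intro m
  induction m with
  | zero =>
    intro x y hx hy
    have hx0 : x = 0 := by simpa using hx
    have hy0 : y = 0 := by simpa using hy
    subst hx0; subst hy0
    simp only [Finset.univ_eq_empty, Finset.sum_empty, Finset.mem_zero]
    ext i; fin_cases i <;> simp
  | succ m ih =>
    intro x y hx hy
    have hB : 0 < (b ^ 2) ^ m := by positivity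
    have hB' : 0 < b ^ m := by positivity
    set d := x / (b ^ 2) ^ m with hd
    set x' := x % (b ^ 2) ^ m with hx'
    set e := y / b ^ m with he
    set y' := y % b ^ m with hy'
    have hdx : d < b ^ 2 := by
      rw [hd]; exact Nat.div_lt_of_lt_mul (by rw [← pow_succ]; exact hx)
    have hey : e < b := by
      rw [he]; exact Nat.div_lt_of_lt_mul (by rw [← pow_succ]; exact hy)
    have hx'lt : x' < (b ^ 2) ^ m := Nat.mod_lt _ hB
    have hy'lt : y' < b ^ m := Nat.mod_lt _ hB'
    have hxe : x = x' + (b ^ 2) ^ m * d := (Nat.mod_add_div x _).symm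
    have hye : y = y' + b ^ m * e := (Nat.mod_add_div y _).symm
    rw [Fin.sum_univ_castSucc]
    simp only [Fin.val_castSucc, Fin.val_last]
    have hmem' := ih x' y' hx'lt hy'lt
    have hlast : (![(b : ℝ) ^ (2 * m) * (d : ℝ), (b : ℝ) ^ m * (e : ℝ)] : Fin 2 → ℝ) ∈ example3Set b m :=
      Finset.mem_image.2 ⟨(d, e), Finset.mem_product.2 ⟨Finset.mem_range.2 hdx, Finset.mem_range.2 hey⟩, rfl⟩
    have hsum : (![(x : ℝ), (y : ℝ)] : Fin 2 → ℝ) =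
        ![(x' : ℝ), (y' : ℝ)] + ![(b : ℝ) ^ (2 * m) * (d : ℝ), (b : ℝ) ^ m * (e : ℝ)] := by
      ext i
      fin_cases i
      · simp only [Fin.zero_eta, Fin.isValue, Matrix.cons_val_zero, Pi.add_apply]
        rw [hxe]; push_cast; ring
      · simp only [Fin.mk_one, Fin.isValue, Matrix.cons_val_one, Matrix.cons_val_zero, Pi.add_apply]
        rw [hye]; push_cast; ring
    rw [hsum]
    exact Finset.add_mem_add hmem' hlast

/-- The parabola chain `{(j², j) : j < n} ⊂ ℝ²` (variant of the chain of KPTT Lemma 2, which uses `(j(j-1)/2, j)`).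
[cite: KoiranPortierTavenasThomasse2015, Lemma 2] -/
def parabolaChain (n : ℕ) : Finset (Fin 2 → ℝ) :=
  (Finset.range n).image fun j : ℕ => ![((j : ℝ)) ^ 2, (j : ℝ)]

/-- `#parabolaChain n = n` (the `n` endpoints of KPTT Lemma 2, parabola variant). [cite: KoiranPortierTavenasThomasse2015, Lemma 2] -/
theorem card_parabolaChain (n : ℕ) : (parabolaChain n).card = n := by
  unfold parabolaChain
  rw [Finset.card_image_of_injective, Finset.card_range]
  intro j j' h
  have h1 := congrFun h 1
  simp only [Matrix.cons_val_one, Matrix.cons_val_zero] at h1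
  exact_mod_cast h1

/-- **The parabola chain is convexly independent**: the linear functional `(x,y) ↦ x − 2k·y` separates `(k², k)` strictly from
the other chain points (its value there exceeds the value at `(k², k)` by `(j − k)²`) — KPTT Lemma 2 ("the `n-1` segments have `n`
endpoints and they are convexly independent"), parabola variant. [cite: KoiranPortierTavenasThomasse2015, Lemma 2] -/
theorem convexIndependent_parabolaChain (n : ℕ) :
    ConvexIndependent ℝ (Subtype.val : ↥(parabolaChain n : Set (Fin 2 → ℝ)) → (Fin 2 → ℝ)) := by
  rw [convexIndependent_set_iff_notMem_convexHull_sdiff]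
  intro p hp hconv
  obtain ⟨k, -, rfl⟩ := Finset.mem_image.1 (Finset.mem_coe.1 hp)
  -- the separating open half-space
  let L : (Fin 2 → ℝ) → ℝ := fun z => z 0 - 2 * (k : ℝ) * z 1
  have hL : IsLinearMap ℝ L := by
    refine ⟨fun z w => ?_, fun c z => ?_⟩
    · simp only [L, Pi.add_apply]; ring
    · simp only [L, Pi.smul_apply, smul_eq_mul]; ring
  set H : Set (Fin 2 → ℝ) := {z | L ![((k : ℝ)) ^ 2, (k : ℝ)] < L z} with hH
  have hconvH : Convex ℝ H := convex_halfSpace_gt hL _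
  have hsub : (↑(parabolaChain n) : Set (Fin 2 → ℝ)) \ {![((k : ℝ)) ^ 2, (k : ℝ)]} ⊆ H := by
    intro z hz
    obtain ⟨hz, hzk⟩ := hz
    obtain ⟨j, -, rfl⟩ := Finset.mem_image.1 (Finset.mem_coe.1 hz)
    have hjk : (j : ℝ) ≠ k := by
      intro h
      apply hzk
      have : j = k := by exact_mod_cast h
      rw [this]; rfl
    show L ![((k : ℝ)) ^ 2, (k : ℝ)] < L ![((j : ℝ)) ^ 2, (j : ℝ)]
    simp only [L, Matrix.cons_val_zero, Matrix.cons_val_one]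
    have : (0 : ℝ) < ((j : ℝ) - k) ^ 2 := by positivity
    nlinarith
  have hmem := convexHull_min hsub hconvH hconv
  rw [hH, Set.mem_setOf_eq] at hmem
  exact lt_irrefl _ hmem

/-- The parabola chain with `b^m - 1` points lies in the Minkowski sum of Example 3 (KPTT, proof of Proposition 1: "choosing
`M = b^{2m}` and `N = b^m` … `n < b^m`"). [cite: KoiranPortierTavenasThomasse2015, Proposition 1 (proof)] -/
theorem parabolaChain_subset_sum (b m : ℕ) (hb : 2 ≤ b) :
    (↑(parabolaChain (b ^ m - 1)) : Set (Fin 2 → ℝ)) ⊆ ↑(∑ k : Fin m, example3Set b k) := by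
  intro p hp
  obtain ⟨j, hj, rfl⟩ := Finset.mem_image.1 (Finset.mem_coe.1 hp)
  rw [Finset.mem_range] at hj
  have hbm : 1 ≤ b ^ m := Nat.one_le_pow _ _ (by omega)
  have hjlt : j < b ^ m := by omega
  have hj2 : j ^ 2 < (b ^ 2) ^ m := by
    rw [← pow_mul, mul_comm, pow_mul]
    exact Nat.pow_lt_pow_left hjlt two_ne_zero
  have h := grid_mem_sum_example3Set b (by omega) m (j ^ 2) j hj2 hjlt
  have e : (![((j : ℝ)) ^ 2, (j : ℝ)] : Fin 2 → ℝ) = ![((j ^ 2 : ℕ) : ℝ), (j : ℝ)] := by push_cast; rfl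
  rw [Finset.mem_coe, e]
  exact h

/-- **KPTT 2015, Proposition 1 holds.** [cite: KoiranPortierTavenasThomasse2015, Proposition 1] -/
theorem kptt_proposition1_holds : Literature.Computability.AlgebraicComplexity.KPTT.proposition1 := by
  intro m b hb
  refine ⟨fun k => example3Set b k, fun k => card_example3Set b k (by omega), parabolaChain (b ^ m - 1),
    parabolaChain_subset_sum b m hb, convexIndependent_parabolaChain _, ?_⟩
  rw [card_parabolaChain]

end Literature.Computability.AlgebraicComplexity.KPTT

end
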